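import Summits.CriticalPhenomena.PercolationContinuityZ3.Theorems.PercNearOneGluingNoHeavyLowerTailMajorityGluingTypeBridgeRowTable
import Summits.CriticalPhenomena.PercolationContinuityZ3.Theorems.PercNearOneGluingNoHeavyLowerTailMajorityGluingTypeBridgeLaw
import Summits.CriticalPhenomena.PercolationContinuityZ3.Theorems.PercNearOneGluingNoHeavyLowerTailMajorityGluingBudgetRow
import HarnessLib

/-!
# The TYPE BRIDGE, part V: the 49 linear vdBHK rows of `SymLaw` hold for the law of the hub gadget (lane prim-rate, constants-miner 1, gen 31; CANDIDATES §GEN-17 R135/R147, §GEN-31)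

Support file for the closed crux `NoHeavyLowerTail` (stmt-CriticalPhenomena-4575), majority-gluing line.  For Bernoulli bond percolation on the
pairs of `Fin n`, a hub `a` and distinct relays `v 1, …, v 4 ≠ a` labelled so that `v 1` has the largest cut probability
(`μ(v x ↮ a) ≤ μ(v 1 ↮ a)`), the scale-free law `law w a v M` of the gadget on the 94 types (part III) satisfies ALL 22 `O`-free linear rows
(`linFree_law : ∀ φ ∈ linFree, lin φ (law) ≤ 0`), and, if moreover `μ(v 2 ↮ a) ≥ μ(v 3 ↮ a) ≥ μ(v 4 ↮ a)`, all 27 `O`-rows (`linOrd_law`).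
Proof: by part IV each row functional at `typeOf ω` is the value of a budget-row specification at the shape of `ω`; its integral is
`μ(COND ∧ v t cut) − μ(COND ∧ v s cut)` (`integral_eval`), which is `≤ 0` by the percolation budget inequalities `Budget.budget_row` (down rows)
/ `Budget.budget_row_up` (up rows) — van den Berg–Häggström–Kahn 2006 Thm 1.3 — or directly by the ordering of the marginals (plain rows)
(`integral_eval_nonpos`).  No sorries. [cite: VandenbergHaggstromKahn2005, Thm. 1.3 (p. 6)]
-/

noncomputable section

namespace Summit.CriticalPhenomena.PercolationContinuityZ3.Theorems

open MeasureTheory Set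
open Literature.Probability.LatticeModels (prodBernoulli)
open Literature.Probability.Percolation

namespace HubOnly
namespace TypeTable

/-- The four indices are the four relays. -/
def RowSpec.memB (r : RowSpec) : Bool := decide (r.s ∈ [1, 2, 3, 4] ∧ r.t ∈ [1, 2, 3, 4] ∧ r.k ∈ [1, 2, 3, 4] ∧ r.l ∈ [1, 2, 3, 4])

/-- The four indices are pairwise distinct. -/
def RowSpec.distinctB (r : RowSpec) : Bool :=
  decide (r.s ≠ r.t ∧ r.s ≠ r.k ∧ r.s ≠ r.l ∧ r.t ≠ r.k ∧ r.t ≠ r.l ∧ r.k ≠ r.l)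

/-- `Q` is monotone (up rows). -/
def RowSpec.QUpB (r : RowSpec) : Bool :=
  decide (∀ b1 b2 b1' b2' : Bool, (b1 = true → b1' = true) → (b2 = true → b2' = true) → r.Q b1 b2 = true → r.Q b1' b2' = true)

/-- `Q` is antitone (down rows). -/
def RowSpec.QDownB (r : RowSpec) : Bool :=
  decide (∀ b1 b2 b1' b2' : Bool, (b1 = true → b1' = true) → (b2 = true → b2' = true) → r.Q b1' b2' = true → r.Q b1 b2 = true)

/-- The side conditions of a specification as one Boolean: indices = the four relays, pairwise distinct, and `Q` monotone (up rows)
resp. antitone (down rows). -/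
def RowSpec.goodB (r : RowSpec) : Bool :=
  r.memB && r.distinctB && (r.plain || (if r.up then r.QUpB else r.QDownB))

/-- The `O`-free specifications are good, with `s = 1` and `t ∈ {2,3,4}`. -/
theorem linFreeSpec_good : ∀ r ∈ linFreeSpec, r.goodB = true ∧ r.s = 1 ∧ r.t ∈ [2, 3, 4] := by decide

/-- The `O`-row specifications are good, with `(s,t) ∈ {(2,3),(2,4),(3,4)}`. -/
theorem linOrdSpec_good : ∀ r ∈ linOrdSpec, r.goodB = true ∧ ((r.s = 2 ∧ r.t = 3) ∨ (r.s = 2 ∧ r.t = 4) ∨ (r.s = 3 ∧ r.t = 4)) := by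
  decide

namespace Bridge

open Refresh
open scoped Classical

variable {n : ℕ}

/-- **The integral of a specification's value**: `E[(cut_t − cut_s)·1[COND]] = μ(COND ∧ v t cut) − μ(COND ∧ v s cut)`. -/
theorem integral_eval (w : Sym2 (Fin n) → unitInterval) (a : Fin n) (v : ℕ → Fin n) (r : RowSpec) :
    ∫ ω, (r.eval (shapeOf a v ω) : ℝ) ∂(prodBernoulli w) =
      (prodBernoulli w).real {ω : BondConfig (Fin n) | r.cond (shapeOf a v ω) = true ∧ (shapeOf a v ω).cutf r.t = true} -
        (prodBernoulli w).real {ω : BondConfig (Fin n) | r.cond (shapeOf a v ω) = true ∧ (shapeOf a v ω).cutf r.s = true} := by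
  rw [← integral_indicator_one (MeasurableSet.of_discrete :
      MeasurableSet {ω : BondConfig (Fin n) | r.cond (shapeOf a v ω) = true ∧ (shapeOf a v ω).cutf r.t = true}),
    ← integral_indicator_one (MeasurableSet.of_discrete :
      MeasurableSet {ω : BondConfig (Fin n) | r.cond (shapeOf a v ω) = true ∧ (shapeOf a v ω).cutf r.s = true}),
    ← integral_sub Integrable.of_finite Integrable.of_finite]
  refine integral_congr_ae (Filter.Eventually.of_forall fun ω => ?_)
  simp only [RowSpec.eval]
  by_cases hc : r.cond (shapeOf a v ω) = true
  · rw [if_pos hc]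
    by_cases ht : (shapeOf a v ω).cutf r.t = true <;> by_cases hs : (shapeOf a v ω).cutf r.s = true <;>
      simp [DType.ind, hc, ht, hs, Set.indicator]
  · rw [if_neg hc]
    simp [hc, Set.indicator]

/-- **A good specification with `μ(v t cut) ≤ μ(v s cut)` has non-positive integral** — the budget inequalities of
`…MajorityGluingBudgetRow` (down / up rows) or the ordering of the marginals (plain rows). [cite: VandenbergHaggstromKahn2005, Thm. 1.3 (p. 6)] -/
theorem integral_eval_nonpos (w : Sym2 (Fin n) → unitInterval) (a : Fin n) (v : ℕ → Fin n) (hv : ∀ x ∈ [1, 2, 3, 4], v x ≠ a)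
    (hinj : ∀ x ∈ [1, 2, 3, 4], ∀ y ∈ [1, 2, 3, 4], v x = v y → x = y) (r : RowSpec) (hg : r.goodB = true)
    (hδ : (prodBernoulli w).real {ω : BondConfig (Fin n) | ¬ (openGraph ω).Reachable a (v r.t)} ≤
      (prodBernoulli w).real {ω : BondConfig (Fin n) | ¬ (openGraph ω).Reachable a (v r.s)}) :
    ∫ ω, (r.eval (shapeOf a v ω) : ℝ) ∂(prodBernoulli w) ≤ 0 := by
  simp only [RowSpec.goodB, Bool.and_eq_true, Bool.or_eq_true] at hg
  obtain ⟨⟨hmem, hdis⟩, hQ⟩ := hg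
  obtain ⟨hs, ht, hk, hl⟩ := of_decide_eq_true hmem
  obtain ⟨hst, hsk, hsl, htk, htl, hkl⟩ := of_decide_eq_true hdis
  have hsame := shapeOf_same a v
  have hcut := shapeOf_cutf a v
  have hvst : v r.s ≠ v r.t := fun h => hst (hinj _ hs _ ht h)
  rw [integral_eval, sub_nonpos]
  by_cases hplain : r.plain = true
  · -- plain rows: the condition is trivial
    have hc : ∀ ω, r.cond (shapeOf a v ω) = true := fun ω => by simp [RowSpec.cond, hplain]
    have e1 : {ω : BondConfig (Fin n) | r.cond (shapeOf a v ω) = true ∧ (shapeOf a v ω).cutf r.t = true} =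
        {ω | ¬ (openGraph ω).Reachable a (v r.t)} := by
      ext ω; simp only [mem_setOf_eq, hc ω, true_and, hcut ω r.t ht, decide_eq_true_eq]
    have e2 : {ω : BondConfig (Fin n) | r.cond (shapeOf a v ω) = true ∧ (shapeOf a v ω).cutf r.s = true} =
        {ω | ¬ (openGraph ω).Reachable a (v r.s)} := by
      ext ω; simp only [mem_setOf_eq, hc ω, true_and, hcut ω r.s hs, decide_eq_true_eq]
    rw [e1, e2]; exact hδ
  · have hplain' : r.plain = false := by simpa using hplain
    by_cases hup : r.up = true
    · -- up rows: block of `t`, `s ∉ B_t`, up-closed test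
      set U : Finset (Fin n) → Prop := fun S => r.Q (decide (v r.k ∈ S)) (decide (v r.l ∈ S)) = true with hU
      have hQup : r.QUpB = true := by
        rcases hQ with hq | hq
        · rw [hplain'] at hq; cases hq
        · rw [hup] at hq; simpa using hq
      have hUmono : ∀ S S' : Finset (Fin n), S ⊆ S' → U S → U S' := fun S S' hSS' h =>
        of_decide_eq_true hQup _ _ _ _ (fun hb => decide_eq_true (hSS' (of_decide_eq_true hb)))
          (fun hb => decide_eq_true (hSS' (of_decide_eq_true hb))) h
      have hc : ∀ ω, r.cond (shapeOf a v ω) = true ↔ (U (clusOff {a} ω (v r.t)) ∧ v r.s ∉ clusOff {a} ω (v r.t)) := by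
        intro ω
        simp only [RowSpec.cond, hplain', hup, if_true, Bool.false_eq_true, if_false, Bool.and_eq_true, Bool.not_eq_true',
          hsame ω r.t ht r.s hs, hsame ω r.t ht r.k hk, hsame ω r.t ht r.l hl, hU, decide_eq_false_iff_not]
        tauto
      have e : ∀ x ∈ [1, 2, 3, 4], {ω : BondConfig (Fin n) | r.cond (shapeOf a v ω) = true ∧ (shapeOf a v ω).cutf x = true} =
          {ω | ¬ (openGraph ω).Reachable a (v x) ∧ (U (clusOff {a} ω (v r.t)) ∧ v r.s ∉ clusOff {a} ω (v r.t))} := by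
        intro x hx; ext ω
        simp only [mem_setOf_eq, hc ω, hcut ω x hx, decide_eq_true_eq]
        tauto
      rw [e r.t ht, e r.s hs]
      exact Budget.budget_row_up w a (v r.s) (v r.t) (hv _ hs) (hv _ ht) hvst U hUmono hδ
    · -- down rows: block of `s`, `t ∉ B_s`, down-closed test
      have hup' : r.up = false := by simpa using hup
      set P : Finset (Fin n) → Prop := fun S => r.Q (decide (v r.k ∈ S)) (decide (v r.l ∈ S)) = true with hP
      have hQdown : r.QDownB = true := by
        rcases hQ with hq | hq
        · rw [hplain'] at hq; cases hq
        · rw [hup'] at hq; simpa using hq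
      have hPanti : ∀ S S' : Finset (Fin n), S ⊆ S' → P S' → P S := fun S S' hSS' h =>
        of_decide_eq_true hQdown _ _ _ _ (fun hb => decide_eq_true (hSS' (of_decide_eq_true hb)))
          (fun hb => decide_eq_true (hSS' (of_decide_eq_true hb))) h
      have hc : ∀ ω, r.cond (shapeOf a v ω) = true ↔ (P (clusOff {a} ω (v r.s)) ∧ v r.t ∉ clusOff {a} ω (v r.s)) := by
        intro ω
        simp only [RowSpec.cond, hplain', hup', Bool.false_eq_true, if_false, Bool.and_eq_true, Bool.not_eq_true',
          hsame ω r.s hs r.t ht, hsame ω r.s hs r.k hk, hsame ω r.s hs r.l hl, hP, decide_eq_false_iff_not]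
        tauto
      have e : ∀ x ∈ [1, 2, 3, 4], {ω : BondConfig (Fin n) | r.cond (shapeOf a v ω) = true ∧ (shapeOf a v ω).cutf x = true} =
          {ω | ¬ (openGraph ω).Reachable a (v x) ∧ (P (clusOff {a} ω (v r.s)) ∧ v r.t ∉ clusOff {a} ω (v r.s))} := by
        intro x hx; ext ω
        simp only [mem_setOf_eq, hc ω, hcut ω x hx, decide_eq_true_eq]
        tauto
      rw [e r.t ht, e r.s hs]
      exact Budget.budget_row w a (v r.s) (v r.t) (hv _ hs) (hv _ ht) hvst P hPanti hδ

/-- **THE 22 `O`-FREE LINEAR vdBHK ROWS HOLD FOR THE LAW OF THE HUB GADGET.**  Hub `a`, distinct relays `v 1, …, v 4 ≠ a` with `v 1` of largest cut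
probability, `M > 0`: `∀ φ ∈ linFree, lin φ (law w a v M) ≤ 0`. [cite: VandenbergHaggstromKahn2005, Thm. 1.3 (p. 6)] -/
theorem linFree_law (w : Sym2 (Fin n) → unitInterval) (a : Fin n) (v : ℕ → Fin n) (hv : ∀ x ∈ [1, 2, 3, 4], v x ≠ a)
    (hinj : ∀ x ∈ [1, 2, 3, 4], ∀ y ∈ [1, 2, 3, 4], v x = v y → x = y) {M : ℝ} (hM : 0 < M)
    (hδ : ∀ x ∈ [2, 3, 4], (prodBernoulli w).real {ω : BondConfig (Fin n) | ¬ (openGraph ω).Reachable a (v x)} ≤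
      (prodBernoulli w).real {ω : BondConfig (Fin n) | ¬ (openGraph ω).Reachable a (v 1)}) :
    ∀ φ ∈ linFree, lin φ (law w a v M) ≤ 0 := by
  intro φ hφ
  obtain ⟨i, hi, rfl⟩ := List.mem_iff_getElem.1 hφ
  rw [lin_law w a v hv]
  refine div_nonpos_of_nonpos_of_nonneg ?_ hM.le
  have hi' : i < linFreeSpec.length := spec_lengths.1 ▸ hi
  obtain ⟨hg, hs1, htm⟩ := linFreeSpec_good _ (List.getElem_mem hi')
  have heq : ∀ ω, ((linFree[i]'hi) (typeOf a v ω) : ℝ) = ((linFreeSpec[i]'hi').eval (shapeOf a v ω) : ℝ) := fun ω => by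
    rw [typeOf, linFree_eval _ (shapeOf_valid a v hv ω) i hi]; rfl
  rw [integral_congr_ae (Filter.Eventually.of_forall heq)]
  refine integral_eval_nonpos w a v hv hinj _ hg ?_
  rw [hs1]; exact hδ _ htm

/-- **THE 27 `O`-ROWS HOLD FOR THE LAW OF THE HUB GADGET** under the WLOG order `μ(v 2 cut) ≥ μ(v 3 cut) ≥ μ(v 4 cut)`.
[cite: VandenbergHaggstromKahn2005, Thm. 1.3 (p. 6)] -/
theorem linOrd_law (w : Sym2 (Fin n) → unitInterval) (a : Fin n) (v : ℕ → Fin n) (hv : ∀ x ∈ [1, 2, 3, 4], v x ≠ a)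
    (hinj : ∀ x ∈ [1, 2, 3, 4], ∀ y ∈ [1, 2, 3, 4], v x = v y → x = y) {M : ℝ} (hM : 0 < M)
    (h32 : (prodBernoulli w).real {ω : BondConfig (Fin n) | ¬ (openGraph ω).Reachable a (v 3)} ≤
      (prodBernoulli w).real {ω : BondConfig (Fin n) | ¬ (openGraph ω).Reachable a (v 2)})
    (h43 : (prodBernoulli w).real {ω : BondConfig (Fin n) | ¬ (openGraph ω).Reachable a (v 4)} ≤
      (prodBernoulli w).real {ω : BondConfig (Fin n) | ¬ (openGraph ω).Reachable a (v 3)}) :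
    ∀ φ ∈ linOrd, lin φ (law w a v M) ≤ 0 := by
  intro φ hφ
  obtain ⟨i, hi, rfl⟩ := List.mem_iff_getElem.1 hφ
  rw [lin_law w a v hv]
  refine div_nonpos_of_nonpos_of_nonneg ?_ hM.le
  have hi' : i < linOrdSpec.length := spec_lengths.2 ▸ hi
  obtain ⟨hg, hst⟩ := linOrdSpec_good _ (List.getElem_mem hi')
  have heq : ∀ ω, ((linOrd[i]'hi) (typeOf a v ω) : ℝ) = ((linOrdSpec[i]'hi').eval (shapeOf a v ω) : ℝ) := fun ω => by
    rw [typeOf, linOrd_eval _ (shapeOf_valid a v hv ω) i hi]; rfl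
  rw [integral_congr_ae (Filter.Eventually.of_forall heq)]
  refine integral_eval_nonpos w a v hv hinj _ hg ?_
  rcases hst with ⟨hs, ht⟩ | ⟨hs, ht⟩ | ⟨hs, ht⟩ <;> rw [hs, ht]
  · exact h32
  · exact h43.trans h32
  · exact h43

end Bridge
end TypeTable
end HubOnly
end Summit.CriticalPhenomena.PercolationContinuityZ3.Theorems
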